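import Summits.CriticalPhenomena.PercolationContinuityZ3.Theorems.Transplant.SkelNegBParamsRootArithP
import HarnessLib

/-!
# N1 params, chain of record `NegB`, part RootArithY: THE INTEGER ARITHMETIC OF THE y′-RUN's FINE READINGS (RULING B.17, three legs) — generic lemmas in the literal
# hypothesis shapes of p3's `rootOblTWAt_negBT_y`: the last core of the y′-run lands in the vertical neighbour's small box (`alongY_pos/alongY_neg`: fine axis 1,
# `20r₁ ± (b0T₁ − 1)`, from the centring of `Ny`; `transY_last`: fine axis 0 within `±(b0T₀ − 1) = ±(10u₀ − 1)`, using the cancellation of the drift `v`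
# against the levels: `m·a − v_L·β′` with `a ≈ (N+1)v_L`, `β′ ≈ (N+1)m`), and the per-REGION level reading `regionY_along` ((L-R5): the prism box is replaced by
# region boxes centred at `k·v`).  Units as in part RootArith (`u = Kq·s`, `D = 640000m`, `U = n_L + |h_L|`); the y′-origin's functional enters through
# `n·Λ₀(yY) = n·Λ₀(yX) + 4σu·n·m + σ'·v_L·m + v_L·ρ` (`0 ≤ ρ < n`: the x-prefix of 4 strides and the `σ'·v_L` window shift).

builds on p205010 (kernel theorem, internal audit signed; external expert review pending) — nothing in this file uses p205010; NOTHING is claimed about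
the node `SamePDropOfSkeletonNeg₁` (OPEN).  Pure arithmetic; no definitions.
Lane `prim-bschramm-*`, seat `prim-bschramm-stmt` (gen 14); helper file (`--supports stmt-CriticalPhenomena-4575 --as helper`); ledger HOME/prim-bschramm-stmt/NEG-PARAMS.md v0.13.
* `mul_window`, `levels_window`, **`transY_last`**, `levels_abs`, `levelH_window`, **`alongY_pos`**, **`alongY_neg`**, **`regionY_along`** (part RootArithY2:
  `regionY_trans`, `prefix_pos`, `prefix_neg`).
[cite: KozmaNitzan2024, §4 p. 28 ((32) at the root), Lemma 11 (p. 22)] [cite: MartineauTassion2017, §4.3 Lemma 4.2]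
-/

namespace Summit.CriticalPhenomena.PercolationContinuityZ3.Theorems.Transplant

namespace PlanarSkeletonNeg

namespace NegB

namespace RootArith

/-- `v·X ≤ v·c + |v|·r` and `v·c − |v|·r ≤ v·X` whenever `|X − c| ≤ r`. [folklore] -/
theorem mul_window {v X c r : ℤ} (h : |X - c| ≤ r) : v * X ≤ v * c + |v| * r ∧ v * c - |v| * r ≤ v * X := by
  have h1 : |v * (X - c)| ≤ |v| * r := by rw [abs_mul]; exact mul_le_mul_of_nonneg_left h (abs_nonneg v)
  obtain ⟨h2, h3⟩ := abs_le.1 h1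
  constructor <;> nlinarith

/-- The level terms of a y′-box: if `U·bmin − U` and `U·bmax + U − 1` both lie in `[c − r, c + r]` then
`max (v(U(bmin−1))) (v(U bmax + U − 1)) ≤ v c + |v| r` and `min … ≥ v c − |v| r`. [folklore] -/
theorem levels_window {v U bmin bmax c r : ℤ} (h1 : |U * bmin - U - c| ≤ r) (h2 : |U * bmax + U - 1 - c| ≤ r) :
    max (v * (U * (bmin - 1))) (v * (U * bmax + U - 1)) ≤ v * c + |v| * r ∧
      v * c - |v| * r ≤ min (v * (U * (bmin - 1))) (v * (U * bmax + U - 1)) := by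
  have e1 : U * (bmin - 1) = U * bmin - U := by ring
  rw [e1]
  obtain ⟨a1, a2⟩ := mul_window (v := v) h1
  obtain ⟨b1, b2⟩ := mul_window (v := v) h2
  exact ⟨max_le a1 b1, le_min a2 b2⟩

/-- **y′-RUN, LAST CORE, ACROSS (fine axis 0), either sign `σ'`**: the fine abscissa of the last core of the y′-run lies in `±(10u − 1)`
(`u = Kq·s₀ ≥ 17`). Data: transverse window `[aL, aH] ⊆ (N+1)v − v ± (n + (N+1)RA)`, levels `U·bL − U ≥ (N+1)m − rβ`, `U·bH + U − 1 ≤ (N+1)m + rβ`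
(`rβ ≤ 2m + 3n`), the origin's functional `nΛ = nΛx + 4σu·n·m + σ'·v·m + v·ρ` (`0 ≤ ρ < n`, `4|Λx| ≤ 7m`). [cite: KozmaNitzan2024, §4 Lemma 11 (p. 22)] -/
theorem transY_last {u m n U v ℓ RA N Λ Λx ρ σ' σu aL aH bL bH rβ : ℤ} (hu : 17 ≤ u) (hn : 1 ≤ n) (hm : n * (ℓ - 1) < m)
    (hU : n ≤ U) (hU' : U ≤ 11 * n) (hv : |v| ≤ n) (hRA : 0 ≤ RA) (hRAn : 2000 * (RA + 2) ≤ n) (hRAℓ : 22000 * (RA + 2) ≤ ℓ)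
    (hN' : N + 1 ≤ 1000) (hσ : σ' = 1 ∨ σ' = -1) (hσu : σu = 1 ∨ σu = -1)
    (haL : (N + 1) * v - v - (n + (N + 1) * RA) ≤ aL) (haLH : aL ≤ aH) (haH : aH ≤ (N + 1) * v - v + (n + (N + 1) * RA))
    (hbL : (N + 1) * m - rβ ≤ U * bL - U) (hbLH : bL ≤ bH) (hbH : U * bH + U - 1 ≤ (N + 1) * m + rβ) (hrβ : 0 ≤ rβ) (hrβ' : rβ ≤ 2 * m + 3 * n)
    (hΛ : n * Λ = n * Λx + 4 * σu * n * m + σ' * v * m + v * ρ) (hρ : 0 ≤ ρ) (hρ' : ρ < n) (hΛx : 4 * |Λx| ≤ 7 * m) :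
    -(10 * u - 1) ≤ (800 * u * (800 * Λ) + 640000 * m / 2) / (640000 * m) +
        (800 * u * (800 * (m * (min (σ' * aL) (σ' * aH)) -
          max (v * (U * (min (σ' * bL) (σ' * bH) - 1))) (v * (U * (max (σ' * bL) (σ' * bH)) + U - 1))) / n)) / (640000 * m) ∧
      (800 * u * (800 * Λ) + 640000 * m / 2) / (640000 * m) +
        (800 * u * (800 * (m * (max (σ' * aL) (σ' * aH)) -
          min (v * (U * (min (σ' * bL) (σ' * bH) - 1))) (v * (U * (max (σ' * bL) (σ' * bH)) + U - 1))) / n)) / (640000 * m) + 1 ≤ 10 * u - 1 := by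
  have hn0 : 0 < n := by linarith
  have hm0 : 0 < m := by
    have := mul_le_mul_of_nonneg_left (show (0:ℤ) ≤ ℓ - 1 by linarith) hn0.le
    linarith
  have hu0 : 0 ≤ u := by linarith
  have hU0 : 0 ≤ U := by linarith
  -- the transverse and level windows in `σ'`-orientation
  set ca := σ' * ((N + 1) * v - v) with hca
  set ra := n + (N + 1) * RA with hra
  have hamin : ca - ra ≤ min (σ' * aL) (σ' * aH) ∧ max (σ' * aL) (σ' * aH) ≤ ca + ra := by
    rcases hσ with rfl | rfl
    · simp only [one_mul] at hca ⊢; rw [min_eq_left haLH, max_eq_right haLH, hca]; constructor <;> linarith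
    · simp only [neg_mul, one_mul] at hca ⊢
      rw [min_eq_right (by linarith : -aH ≤ -aL), max_eq_left (by linarith : -aH ≤ -aL), hca]; constructor <;> linarith
  set cβ := σ' * ((N + 1) * m) with hcβ
  have hUb : U * bL ≤ U * bH := mul_le_mul_of_nonneg_left hbLH hU0
  have hlev : |U * (min (σ' * bL) (σ' * bH)) - U - cβ| ≤ rβ + U ∧ |U * (max (σ' * bL) (σ' * bH)) + U - 1 - cβ| ≤ rβ + U := by
    rcases hσ with rfl | rfl
    · simp only [one_mul] at hcβ ⊢; rw [min_eq_left hbLH, max_eq_right hbLH, hcβ]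
      constructor <;> (rw [abs_le]; constructor <;> linarith)
    · simp only [neg_mul, one_mul] at hcβ ⊢
      rw [min_eq_right (by linarith : -bH ≤ -bL), max_eq_left (by linarith : -bH ≤ -bL), hcβ]
      have e1 : U * -bH = -(U * bH) := by ring
      have e2 : U * -bL = -(U * bL) := by ring
      rw [e1, e2]
      constructor <;> (rw [abs_le]; constructor <;> linarith)
  obtain ⟨hBmax, hBmin⟩ := levels_window (v := v) hlev.1 hlev.2
  set Bmax := max (v * (U * (min (σ' * bL) (σ' * bH) - 1))) (v * (U * (max (σ' * bL) (σ' * bH)) + U - 1))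
  set Bmin := min (v * (U * (min (σ' * bL) (σ' * bH) - 1))) (v * (U * (max (σ' * bL) (σ' * bH)) + U - 1))
  set amin := min (σ' * aL) (σ' * aH)
  set amax := max (σ' * aL) (σ' * aH)
  -- `E_lo ≥ −σ' m v − m ra − |v|(rβ + U)`, `E_hi ≤ −σ' m v + m ra + |v|(rβ + U)`
  have hElo : m * amin - Bmax ≥ -(σ' * (m * v)) - m * ra - |v| * (rβ + U) := by
    have h1 := mul_le_mul_of_nonneg_left hamin.1 hm0.le
    have e : m * (ca - ra) - (v * cβ + |v| * (rβ + U)) = -(σ' * (m * v)) - m * ra - |v| * (rβ + U) := by rw [hca, hcβ]; ring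
    linarith
  have hEhi : m * amax - Bmin ≤ -(σ' * (m * v)) + m * ra + |v| * (rβ + U) := by
    have h1 := mul_le_mul_of_nonneg_left hamin.2 hm0.le
    have e : m * (ca + ra) - (v * cβ - |v| * (rβ + U)) = -(σ' * (m * v)) + m * ra + |v| * (rβ + U) := by rw [hca, hcβ]; ring
    linarith
  -- sizes
  have hra' : 2 * ra ≤ 3 * n := by rw [hra]; nlinarith
  have hvr : |v| * (rβ + U) ≤ n * (2 * m + 14 * n) := mul_le_mul hv (by linarith) (by linarith) hn0.le
  have hm4 : 40000 * n ≤ m := by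
    have := mul_le_mul_of_nonneg_left (show (43999:ℤ) ≤ ℓ - 1 by linarith) hn0.le
    linarith
  have hm8 : 8 * n ≤ m := by linarith
  -- the origin's fine abscissa
  obtain ⟨f1, f2⟩ := coarse_bounds (u := u) (Λ := Λ) hm0
  set F := (800 * u * (800 * Λ) + 640000 * m / 2) / (640000 * m)
  obtain ⟨hΛx1, hΛx2⟩ := abs_le.1 (show |Λx| ≤ 2 * m by linarith [abs_nonneg Λx])
  have hΛx4 := abs_le.1 (show |4 * Λx| ≤ 7 * m by rw [abs_mul]; simpa using hΛx)
  have hvρ : |v * ρ| ≤ n * n := by rw [abs_mul, abs_of_nonneg hρ]; exact mul_le_mul hv hρ'.le hρ hn0.le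
  obtain ⟨hvρ1, hvρ2⟩ := abs_le.1 hvρ
  have hσ'v : |σ' * (m * v)| ≤ m * n := by
    have : |σ'| = 1 := by rcases hσ with h | h <;> simp [h]
    rw [abs_mul, this, one_mul, abs_mul, abs_of_pos hm0]; exact mul_le_mul_of_nonneg_left hv hm0.le
  -- the fine abscissa times `n`: `2mn F ≤ n(2uΛ + m) < 2mnF + 2mn`, and `800u·(nΛ)` expanded by `hΛ`
  have hF1 : n * (2 * m * F) ≤ n * (2 * u * Λ + m) := mul_le_mul_of_nonneg_left f1 hn0.le
  have hF2 : n * (2 * u * Λ + m) < n * (2 * m * F + 2 * m) := mul_lt_mul_of_pos_left f2 hn0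
  have euΛ : u * (n * Λ) = u * (n * Λx) + 4 * u * σu * (n * m) + u * σ' * (v * m) + u * (v * ρ) := by rw [hΛ]; ring
  have hσu8 : u * σu * (n * m) ≥ -(u * (n * m)) ∧ u * σu * (n * m) ≤ u * (n * m) := by
    have hX : 0 ≤ u * (n * m) := by positivity
    have e : u * σu * (n * m) = σu * (u * (n * m)) := by ring
    rw [e]; rcases hσu with h | h <;> rw [h] <;> constructor <;> linarith
  have t1 := mul_le_mul_of_nonneg_left hΛx4.1 (mul_nonneg hu0 hn0.le)
  have t1' := mul_le_mul_of_nonneg_left hΛx4.2 (mul_nonneg hu0 hn0.le)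
  have t2 := mul_le_mul_of_nonneg_left hra' (mul_nonneg hu0 hm0.le)
  have t3 := mul_le_mul_of_nonneg_left hvr hu0
  have t4 := mul_le_mul_of_nonneg_left hvρ1 hu0
  have t4' := mul_le_mul_of_nonneg_left hvρ2 hu0
  have t5 := mul_le_mul_of_nonneg_left hm4 (mul_nonneg hu0 hn0.le)
  have t10 := mul_le_mul_of_nonneg_left (show (1:ℤ) ≤ m from hm0) (mul_nonneg hu0 hn0.le)
  have t6 : 0 ≤ u * (n * m) := by positivity
  have t7 : 17 * (n * m) ≤ u * (n * m) := mul_le_mul_of_nonneg_right hu (by positivity)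
  have t8 := abs_le.1 hσ'v
  have t9 := mul_le_mul_of_nonneg_left hσ'v hu0
  constructor
  · obtain ⟨-, g2⟩ := incr_bounds (u := u) (m := m) (n := n) (a := amin) (B := Bmax) hu0 hm0 hn0
    set G := 800 * u * (800 * (m * amin - Bmax) / n) / (640000 * m)
    have k1 : 800 * m * n * G ≥ 800 * u * (-(σ' * (m * v)) - m * ra - |v| * (rβ + U)) - u * n - 800 * m * n := by
      have := mul_le_mul_of_nonneg_left hElo (by positivity : (0:ℤ) ≤ 800 * u); linarith
    have key : 800 * m * n * (F + G + 10 * u - 1) > 0 := by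
      have e : 800 * m * n * (F + G + 10 * u - 1) = 400 * (n * (2 * m * F)) + 800 * m * n * G + 8000 * (u * (n * m)) - 800 * m * n := by ring
      rw [e]
      have eΛ : n * (2 * u * Λ + m) = 2 * (u * (n * Λ)) + n * m := by ring
      rw [eΛ] at hF2
      have hF2' : 400 * (n * (2 * m * F)) > 800 * (u * (n * Λ)) + 400 * (n * m) - 800 * (m * n) := by
        have : n * (2 * m * F + 2 * m) = n * (2 * m * F) + 2 * (m * n) := by ring
        rw [this] at hF2; linarith
      rw [euΛ] at hF2'
      linarith [hσu8.1, t1, t2, t3, t4, t5, t6, t7, t10, k1, hF2']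
    have hmn : (0 : ℤ) < 800 * m * n := by positivity
    have hX : 0 < F + G + 10 * u - 1 := by
      by_contra hc; push Not at hc
      have := mul_nonpos_of_nonneg_of_nonpos hmn.le hc
      linarith
    linarith
  · obtain ⟨g1, -⟩ := incr_bounds (u := u) (m := m) (n := n) (a := amax) (B := Bmin) hu0 hm0 hn0
    set G := 800 * u * (800 * (m * amax - Bmin) / n) / (640000 * m)
    have k1 : m * n * G ≤ u * (-(σ' * (m * v)) + m * ra + |v| * (rβ + U)) := by
      have := mul_le_mul_of_nonneg_left hEhi hu0; linarith
    have key : 2 * m * n * (F + G + 2 - 10 * u) < 0 := by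
      have e : 2 * m * n * (F + G + 2 - 10 * u) = n * (2 * m * F) + 2 * (m * n * G) + 4 * (m * n) - 20 * (u * (n * m)) := by ring
      rw [e]
      have eΛ : n * (2 * u * Λ + m) = 2 * (u * (n * Λ)) + n * m := by ring
      rw [eΛ, euΛ] at hF1
      linarith [hσu8.2, t1', t2, t3, t4', t5, t6, t7, t10, k1, hF1]
    have hmn : (0 : ℤ) < 2 * m * n := by positivity
    have hX : F + G + 2 - 10 * u < 0 := by
      by_contra hc; push Not at hc
      have := mul_nonneg hmn.le hc
      linarith
    linarith


/-- The two level terms of a `σ'`-oriented level window `[bL, bH]` with `U·bL − U ≥ K·m − rβ`, `U·bH + U − 1 ≤ K·m + rβ` lie within `rβ + U` of `σ'·K·m`. [folklore] -/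
theorem levels_abs {U m K rβ σ' bL bH : ℤ} (hU1 : 1 ≤ U) (hσ : σ' = 1 ∨ σ' = -1) (hbL : K * m - rβ ≤ U * bL - U) (hbLH : bL ≤ bH)
    (hbH : U * bH + U - 1 ≤ K * m + rβ) :
    |U * (min (σ' * bL) (σ' * bH)) - U - σ' * (K * m)| ≤ rβ + U ∧ |U * (max (σ' * bL) (σ' * bH)) + U - 1 - σ' * (K * m)| ≤ rβ + U := by
  have hUb : U * bL ≤ U * bH := mul_le_mul_of_nonneg_left hbLH (by linarith)
  rcases hσ with rfl | rfl
  · simp only [one_mul]; rw [min_eq_left hbLH, max_eq_right hbLH]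
    constructor <;> (rw [abs_le]; constructor <;> linarith)
  · simp only [neg_mul, one_mul]
    rw [min_eq_right (by linarith : -bH ≤ -bL), max_eq_left (by linarith : -bH ≤ -bL)]
    have e1 : U * -bH = -(U * bH) := by ring
    have e2 : U * -bL = -(U * bL) := by ring
    rw [e1, e2]
    constructor <;> (rw [abs_le]; constructor <;> linarith)

/-- **The level reading** `H(X) := ⌊uX/m⌋` of a term within `r` of `σ'·K·m`: `σ'uK − cu ≤ H ≤ σ'uK + cu − 1` once `r + 1 ≤ c·m`. [folklore] -/
theorem levelH_window {u m X K r c σ' : ℤ} (hu : 1 ≤ u) (hm : 0 < m) (hX : |X - σ' * (K * m)| ≤ r) (hr : r + 1 ≤ c * m) :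
    σ' * u * K - c * u ≤ (800 * u * (800 * X)) / (640000 * m) ∧ (800 * u * (800 * X)) / (640000 * m) ≤ σ' * u * K + c * u - 1 := by
  obtain ⟨t1, t2⟩ := trans_bounds (u := u) (m := m) (X := X) hm
  set H := (800 * u * (800 * X)) / (640000 * m)
  obtain ⟨x1, x2⟩ := abs_le.1 hX
  have hu0 : 0 ≤ u := by linarith
  have y1 := mul_le_mul_of_nonneg_left x1 hu0
  have y2 := mul_le_mul_of_nonneg_left x2 hu0
  have hr' := mul_le_mul_of_nonneg_left hr hu0
  constructor
  · by_contra hcn; push Not at hcn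
    have h1 : m * H ≤ m * (σ' * u * K - c * u - 1) := mul_le_mul_of_nonneg_left (by linarith) hm.le
    nlinarith
  · by_contra hcn; push Not at hcn
    have h1 : m * (σ' * u * K + c * u) ≤ m * H := mul_le_mul_of_nonneg_left (by linarith) hm.le
    nlinarith

/-- **y′-RUN, LAST CORE, ALONG (fine axis 1), `σ' = 1`**: `790u + 1 ≤ LLO₁`, `LHI₁ + 1 ≤ 810u − 1` (`u = Kq·s₁`; centring `|F₁ + u(N+1) − 800u| ≤ u`). [cite: KozmaNitzan2024, §4 Lemma 11 (p. 22)] -/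
theorem alongY_pos {u m n U ℓ N Λ σ' bL bH rβ : ℤ} (hu : 1 ≤ u) (hn : 1 ≤ n) (hm : n * (ℓ - 1) < m) (hU : n ≤ U) (hU' : U ≤ 11 * n) (hRAℓ : 44000 ≤ ℓ)
    (hσ : σ' = 1) (hbL : (N + 1) * m - rβ ≤ U * bL - U) (hbLH : bL ≤ bH) (hbH : U * bH + U - 1 ≤ (N + 1) * m + rβ) (hrβ' : rβ ≤ 2 * m + 3 * n)
    (hcen : |(800 * u * (800 * Λ) + 640000 * m / 2) / (640000 * m) + u * (N + 1) - 800 * u| ≤ u) :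
    800 * u - 10 * u + 1 ≤ (800 * u * (800 * Λ) + 640000 * m / 2) / (640000 * m) + (800 * u * (800 * (U * (min (σ' * bL) (σ' * bH) - 1)))) / (640000 * m) ∧
      (800 * u * (800 * Λ) + 640000 * m / 2) / (640000 * m) + (800 * u * (800 * (U * (max (σ' * bL) (σ' * bH)) + U - 1))) / (640000 * m) + 1 ≤ 800 * u + 10 * u - 1 := by
  have hn0 : 0 < n := by linarith
  have hm0 : 0 < m := by have := mul_le_mul_of_nonneg_left (show (0:ℤ) ≤ ℓ - 1 by linarith) hn0.le; linarith
  have hm4 : 40000 * n ≤ m := by have := mul_le_mul_of_nonneg_left (show (43999:ℤ) ≤ ℓ - 1 by linarith) hn0.le; linarith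
  obtain ⟨l1, l2⟩ := levels_abs (K := N + 1) (by linarith) (Or.inl hσ) hbL hbLH hbH
  subst hσ
  have e1 : U * (min (1 * bL) (1 * bH) - 1) = U * (min (1 * bL) (1 * bH)) - U := by ring
  rw [e1]
  obtain ⟨a1, -⟩ := levelH_window (c := 3) (σ' := 1) hu hm0 l1 (by linarith)
  obtain ⟨-, b2⟩ := levelH_window (c := 3) (σ' := 1) hu hm0 l2 (by linarith)
  have hc := abs_le.1 hcen
  constructor <;> linarith

/-- **y′-RUN, LAST CORE, ALONG, `σ' = −1`**: `790u + 1 ≤ −LHI₁ − 1`, `−LLO₁ ≤ 810u − 1`. [cite: KozmaNitzan2024, §4 Lemma 11 (p. 22)] -/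
theorem alongY_neg {u m n U ℓ N Λ σ' bL bH rβ : ℤ} (hu : 1 ≤ u) (hn : 1 ≤ n) (hm : n * (ℓ - 1) < m) (hU : n ≤ U) (hU' : U ≤ 11 * n) (hRAℓ : 44000 ≤ ℓ)
    (hσ : σ' = -1) (hbL : (N + 1) * m - rβ ≤ U * bL - U) (hbLH : bL ≤ bH) (hbH : U * bH + U - 1 ≤ (N + 1) * m + rβ) (hrβ' : rβ ≤ 2 * m + 3 * n)
    (hcen : |(800 * u * (800 * Λ) + 640000 * m / 2) / (640000 * m) - u * (N + 1) + 800 * u| ≤ u) :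
    800 * u - 10 * u + 1 ≤ -((800 * u * (800 * Λ) + 640000 * m / 2) / (640000 * m) + (800 * u * (800 * (U * (max (σ' * bL) (σ' * bH)) + U - 1))) / (640000 * m) + 1) ∧
      -((800 * u * (800 * Λ) + 640000 * m / 2) / (640000 * m) + (800 * u * (800 * (U * (min (σ' * bL) (σ' * bH) - 1)))) / (640000 * m)) ≤ 800 * u + 10 * u - 1 := by
  have hn0 : 0 < n := by linarith
  have hm0 : 0 < m := by have := mul_le_mul_of_nonneg_left (show (0:ℤ) ≤ ℓ - 1 by linarith) hn0.le; linarith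
  have hm4 : 40000 * n ≤ m := by have := mul_le_mul_of_nonneg_left (show (43999:ℤ) ≤ ℓ - 1 by linarith) hn0.le; linarith
  obtain ⟨l1, l2⟩ := levels_abs (K := N + 1) (by linarith) (Or.inr hσ) hbL hbLH hbH
  subst hσ
  have e1 : U * (min (-1 * bL) (-1 * bH) - 1) = U * (min (-1 * bL) (-1 * bH)) - U := by ring
  rw [e1]
  obtain ⟨-, a2⟩ := levelH_window (c := 3) (σ' := -1) hu hm0 l2 (by linarith)
  obtain ⟨b1, -⟩ := levelH_window (c := 3) (σ' := -1) hu hm0 l1 (by linarith)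
  have hc := abs_le.1 hcen
  constructor <;> linarith

/-- **y′-RUN, REGION `k`, ALONG, `σ' = ±1`**: the level reading of region `k` (`0 ≤ k ≤ N`, terms within `r ≤ 7m − 1` of `σ'km`) lies in `[−5r₁+1, 25r₁−1]`
(`r₁ = 40u`), given `|F₁| ≤ 4u` hmm — via the centring `|F₁ + σ'u(N+1) − σ'800u| ≤ u` and `|Λ₁| ≤ 3m`. [cite: KozmaNitzan2024, §4 p. 28] -/
theorem regionY_along {u m n ℓ N k Λ σ' X1 X2 r : ℤ} (hu : 1 ≤ u) (hn : 1 ≤ n) (hm : n * (ℓ - 1) < m) (hRAℓ : 44000 ≤ ℓ) (hσ : σ' = 1 ∨ σ' = -1)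
    (hk : 0 ≤ k) (hkN : k ≤ N) (hX1 : |X1 - σ' * (k * m)| ≤ r) (hX2 : |X2 - σ' * (k * m)| ≤ r) (hr : r + 1 ≤ 7 * m) (hΛ : |Λ| ≤ 3 * m)
    (hcen : |(800 * u * (800 * Λ) + 640000 * m / 2) / (640000 * m) + σ' * u * (N + 1) - σ' * 800 * u| ≤ u) :
    (σ' = 1 → -(5 * (40 * u)) + 1 ≤ (800 * u * (800 * Λ) + 640000 * m / 2) / (640000 * m) + (800 * u * (800 * X1)) / (640000 * m) ∧
        (800 * u * (800 * Λ) + 640000 * m / 2) / (640000 * m) + (800 * u * (800 * X2)) / (640000 * m) + 1 ≤ 25 * (40 * u) - 1) ∧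
      (σ' = -1 → -(5 * (40 * u)) + 1 ≤ -((800 * u * (800 * Λ) + 640000 * m / 2) / (640000 * m) + (800 * u * (800 * X2)) / (640000 * m) + 1) ∧
        -((800 * u * (800 * Λ) + 640000 * m / 2) / (640000 * m) + (800 * u * (800 * X1)) / (640000 * m)) ≤ 25 * (40 * u) - 1) := by
  have hn0 : 0 < n := by linarith
  have hm0 : 0 < m := by have := mul_le_mul_of_nonneg_left (show (0:ℤ) ≤ ℓ - 1 by linarith) hn0.le; linarith
  have hu0 : 0 ≤ u := by linarith
  obtain ⟨f1, f2⟩ := coarse_bounds (u := u) (Λ := Λ) hm0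
  set F := (800 * u * (800 * Λ) + 640000 * m / 2) / (640000 * m)
  obtain ⟨hΛ1, hΛ2⟩ := abs_le.1 hΛ
  have hFlo : -3 * u ≤ F := by
    by_contra hc; push Not at hc
    have h1 : 2 * m * F ≤ 2 * m * (-3 * u - 1) := mul_le_mul_of_nonneg_left (by linarith) (by positivity)
    nlinarith
  have hFhi : F ≤ 3 * u := by
    by_contra hc; push Not at hc
    have h1 : 2 * m * (3 * u + 1) ≤ 2 * m * F := mul_le_mul_of_nonneg_left (by linarith) (by positivity)
    nlinarith
  obtain ⟨a1, a2⟩ := levelH_window (c := 7) hu hm0 hX1 hr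
  obtain ⟨b1, b2⟩ := levelH_window (c := 7) hu hm0 hX2 hr
  have hc := abs_le.1 hcen
  have hukN : u * k ≤ u * N := mul_le_mul_of_nonneg_left hkN hu0
  have huk0 : 0 ≤ u * k := mul_nonneg hu0 hk
  constructor
  · intro h1; subst h1; simp only [one_mul] at a1 a2 b1 b2 hc; constructor <;> nlinarith
  · intro h1; subst h1; simp only [neg_mul, one_mul] at a1 a2 b1 b2 hc; constructor <;> nlinarith

end RootArith

end NegB

end PlanarSkeletonNeg

end Summit.CriticalPhenomena.PercolationContinuityZ3.Theorems.Transplant
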